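import Summits.ValiantsHypothesis.ValiantsHypothesis.Theses.TwistedDetRank
import Literature.LinearAlgebra.Matrix.PermanentLaplace
import Literature.Computability.AlgebraicComplexity.CNFPermanentTwoSite

/-!
# Route `TwistedDetRank` — `TdrBlockMonotone` (item stmt-ValiantsHypothesis-6287)

Block restriction keeps the number of twisted determinants: if `3m ≤ n` and the generic permanent
`per_n` is a sum of `r` Hadamard-twisted determinants `det (E_t ∘ X)`, then the direct sum
`per_3 ⊕ ⋯ ⊕ per_3` (the product of the permanents of the `m` diagonal `3 × 3` blocks of a
`(Fin m × Fin 3)`-indexed generic matrix `Y`) is a sum of `r` twisted determinants `det (E'_t ∘ Y)`.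

Proof (substitution). Re-index `Fin n ≃ Fin k ⊕ (Fin m × Fin 3)` (`k = n - 3m`; any equivalence
will do) and apply the algebra homomorphism `φ = MvPolynomial.aeval` sending `X_{ij}` to the entry
`G (ε i) (ε j)` of the block sum `G` of the identity matrix on `Fin k` and the `m` generic `3 × 3`
blocks (`ThreeCNFPer.blockSum`): off-block variables go to `0`, leftover diagonal variables to `1`.
Then `φ (per_n) = per G = ∏_b per (Y_b)` (`ThreeCNFPer.permanent_blockSum`), while
`φ (det (E_t ∘ X)) = det (diag (E_t|leftover)) · det (E''_t ∘ Y) = C (c_t) · det (E''_t ∘ Y)` with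
`E''_t` the block-diagonal part of the twist; the scalar `c_t` is absorbed into one row of the
twist (`Matrix.det_mul_column`).
-/

-- `Summit.<Summit>.<Problem>` repeats `ValiantsHypothesis` by the tree's layout convention (D-0017).
set_option linter.dupNamespace false

namespace Summit.ValiantsHypothesis.ValiantsHypothesis.Theorems

open MvPolynomial
open Literature.Computability.AlgebraicComplexity

/-- **Block restriction of a twisted-determinant representation of the permanent.** If `1 ≤ m`,
`3m ≤ n` and `per_n = ∑_t det (E_t ∘ X)` with `r` twists `E_t ∈ ℂ^{n×n}`, then the product of the
permanents of the `m` diagonal `3 × 3` blocks of a `(Fin m × Fin 3)`-indexed generic matrix is a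
sum of `r` twisted determinants of that matrix. -/
theorem tdr_block_restrict {n m r : ℕ} (hm : 1 ≤ m) (hmn : 3 * m ≤ n)
    (E : Fin r → Matrix (Fin n) (Fin n) ℂ)
    (hE : perPoly (Fin n) ℂ = ∑ t, (Matrix.of fun i j => C (E t i j) * X (i, j)).det) :
    ∃ E' : Fin r → Matrix (Fin m × Fin 3) (Fin m × Fin 3) ℂ,
      (∏ b : Fin m, ∑ σ : Equiv.Perm (Fin 3), ∏ i : Fin 3,
          (X ((b, σ i), (b, i)) : MvPolynomial ((Fin m × Fin 3) × (Fin m × Fin 3)) ℂ)) =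
        ∑ t, (Matrix.of fun p q => C (E' t p q) * X (p, q)).det := by
  obtain ⟨k, hk⟩ : ∃ k, k + m * 3 = n := ⟨n - m * 3, by omega⟩
  -- any re-indexing of `Fin n` as `Fin k ⊕ (Fin m × Fin 3)`
  obtain ⟨ε⟩ : Nonempty (Fin n ≃ (Fin k ⊕ Fin m × Fin 3)) := by
    refine ⟨(Fintype.equivFinOfCardEq ?_).symm⟩
    simp only [Fintype.card_sum, Fintype.card_prod, Fintype.card_fin, hk]
  -- the substituted matrix: identity on the leftover indices, generic on the diagonal blocks
  set G : Matrix (Fin k ⊕ Fin m × Fin 3) (Fin k ⊕ Fin m × Fin 3)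
      (MvPolynomial ((Fin m × Fin 3) × (Fin m × Fin 3)) ℂ) :=
    ThreeCNFPer.blockSum (1 : Matrix (Fin k) (Fin k) _)
      (fun b : Fin m => Matrix.of fun a a' : Fin 3 =>
        (X ((b, a), (b, a')) : MvPolynomial ((Fin m × Fin 3) × (Fin m × Fin 3)) ℂ)) with hG
  -- the substitution
  set φ : MvPolynomial (Fin n × Fin n) ℂ →ₐ[ℂ] MvPolynomial ((Fin m × Fin 3) × (Fin m × Fin 3)) ℂ :=
    aeval (fun ij : Fin n × Fin n => G (ε ij.1) (ε ij.2)) with hφ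
  have hφX : ∀ i j : Fin n, φ (X (i, j)) = G (ε i) (ε j) := fun i j => by
    simp [hφ]
  have hφC : ∀ c : ℂ, φ (C c) = C c := fun c => by
    simp [hφ]
  -- the permanent side: `φ (per_n) = per G = ∏_b per (Y_b)`
  have hper : φ (perPoly (Fin n) ℂ) = ∏ b : Fin m, ∑ σ : Equiv.Perm (Fin 3), ∏ i : Fin 3,
      (X ((b, σ i), (b, i)) : MvPolynomial ((Fin m × Fin 3) × (Fin m × Fin 3)) ℂ) := by
    have h1 : φ (perPoly (Fin n) ℂ) = (G.submatrix ε ε).permanent := by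
      simp only [perPoly, Matrix.permanent, map_sum, map_prod, Matrix.mvPolynomialX_apply, hφX,
        Matrix.submatrix_apply]
    rw [h1, Matrix.permanent_submatrix_equiv, hG, ThreeCNFPer.permanent_blockSum,
      Matrix.permanent_one, one_mul]
    simp only [Matrix.permanent, Matrix.of_apply]
  -- the leftover scalar and the block-diagonal part of each twist
  let c : Fin r → ℂ := fun t => ∏ i : Fin k, E t (ε.symm (Sum.inl i)) (ε.symm (Sum.inl i))
  let E'' : Fin r → Matrix (Fin m × Fin 3) (Fin m × Fin 3) ℂ := fun t =>
    Matrix.of fun p q => if p.1 = q.1 then E t (ε.symm (Sum.inr p)) (ε.symm (Sum.inr q)) else 0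
  let p₀ : Fin m × Fin 3 := (⟨0, by omega⟩, 0)
  let E' : Fin r → Matrix (Fin m × Fin 3) (Fin m × Fin 3) ℂ := fun t =>
    Matrix.of fun p q => (if p = p₀ then c t else 1) * E'' t p q
  refine ⟨E', ?_⟩
  -- the determinant side
  have hdet : ∀ t : Fin r, φ ((Matrix.of fun i j => C (E t i j) * X (i, j)).det) =
      (Matrix.of fun p q => C (E' t p q) *
        (X (p, q) : MvPolynomial ((Fin m × Fin 3) × (Fin m × Fin 3)) ℂ)).det := by
    intro t
    set H : Matrix (Fin k ⊕ Fin m × Fin 3) (Fin k ⊕ Fin m × Fin 3)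
        (MvPolynomial ((Fin m × Fin 3) × (Fin m × Fin 3)) ℂ) :=
      Matrix.of fun u v => C (E t (ε.symm u) (ε.symm v)) * G u v with hH
    have h1 : φ ((Matrix.of fun i j => C (E t i j) * X (i, j)).det) = (H.submatrix ε ε).det := by
      rw [AlgHom.map_det]
      congr 1
      ext i j
      simp [hH, hφX, hφC]
    rw [h1, Matrix.det_submatrix_equiv_self]
    have h2 : H = Matrix.fromBlocks
        (Matrix.diagonal fun i : Fin k => C (E t (ε.symm (Sum.inl i)) (ε.symm (Sum.inl i)))) 0 0
        (Matrix.of fun p q => C (E'' t p q) *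
          (X (p, q) : MvPolynomial ((Fin m × Fin 3) × (Fin m × Fin 3)) ℂ)) := by
      ext u v
      rcases u with i | ⟨b, a⟩ <;> rcases v with j | ⟨b', a'⟩
      · simp only [hH, hG, Matrix.of_apply, ThreeCNFPer.blockSum_inl_inl, Matrix.fromBlocks_apply₁₁,
          Matrix.one_apply, Matrix.diagonal_apply]
        split_ifs with h
        · subst h; simp
        · simp
      · simp [hH, hG]
      · simp [hH, hG]
      · simp only [hH, hG, Matrix.of_apply, ThreeCNFPer.blockSum_inr_inr, Matrix.fromBlocks_apply₂₂]
        by_cases h : b = b'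
        · subst h; simp [E'']
        · simp [E'', h]
    rw [h2, Matrix.det_fromBlocks_zero₂₁, Matrix.det_diagonal]
    have hc : (∏ i : Fin k, C (E t (ε.symm (Sum.inl i)) (ε.symm (Sum.inl i))) :
        MvPolynomial ((Fin m × Fin 3) × (Fin m × Fin 3)) ℂ) = C (c t) := by
      simp only [c, map_prod]
    have h3 : (Matrix.of fun p q => C (E' t p q) *
          (X (p, q) : MvPolynomial ((Fin m × Fin 3) × (Fin m × Fin 3)) ℂ)) =
        Matrix.of fun p q => (if p = p₀ then C (c t) else 1) *
          (Matrix.of fun p q => C (E'' t p q) *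
            (X (p, q) : MvPolynomial ((Fin m × Fin 3) × (Fin m × Fin 3)) ℂ)) p q := by
      ext p q
      simp only [Matrix.of_apply, E']
      split_ifs <;> simp [map_mul, mul_assoc]
    rw [hc, h3, Matrix.det_mul_column, Finset.prod_ite_eq']
    simp
  -- combine
  have key := congrArg φ hE
  rw [map_sum, hper] at key
  rw [key]
  exact Finset.sum_congr rfl fun t _ => hdet t

/-- Item `stmt-ValiantsHypothesis-6287` (`TdrBlockMonotone`, support of route `TwistedDetRank`):
block restriction keeps the number of twisted determinants — if `1 ≤ m`, `3m ≤ n` and `per_n` is a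
sum of `r` twisted determinants, then `per_3 ⊕ ⋯ ⊕ per_3` (`m` blocks) is a sum of `r` twisted
determinants. -/
theorem tdrBlockMonotone_proof :
    Summit.ValiantsHypothesis.ValiantsHypothesis.Theses.TwistedDetRank.TdrBlockMonotone := by
  unfold Summit.ValiantsHypothesis.ValiantsHypothesis.Theses.TwistedDetRank.TdrBlockMonotone
  intro n m r hm hmn E hE
  exact tdr_block_restrict hm hmn E hE

end Summit.ValiantsHypothesis.ValiantsHypothesis.Theorems
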